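import Literature.NumberTheory.LFunctions.KMVSignedSecondGap
import Summits.Parity.GeneralizedHardyLittlewood.Theses.PrimeLevelFamEdge
import Summits.Parity.GeneralizedHardyLittlewood.Theorems.BeyondDiagonalBeatsQuarter.MollifierMainTermXSq
import Summits.Parity.GeneralizedHardyLittlewood.Theorems.BeyondDiagonalBeatsQuarter.UpperSomewhereBand
import Literature.NumberTheory.LFunctions.KMVSecondMainTermFloorMasses
import Literature.NumberTheory.LFunctions.IwaniecSarnakFamilyWeightTwoPeterssonPB
import HarnessLib

/-!
# K_B (and the registered heart S2u of line `birth`) from the SIGNED prime-averaged second-moment display at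
`(X², 1)`, and from a band along good primes — line `prime-averaged-squeeze` rev 2, Summits side

Supports stmt-Parity-20343 (`BeyondDiagonalBeatsQuarter`, route `PrimeLevelFamEdge` rev 3; D-0130 line A, seat
ls-Bfam-prover-2; `--as helper`, no stub credit). Per the tenure ruling (ls-Bfam-plan g5 12:46:53Z) the stub
registry of the crux is line `birth`'s (`stub_secondCorrectionUpperSomewhere` = S2u, `stub_peterssonBound`);
method lines land helpers and, when their analytic input is proved, take S2u credit by composition. This file
provides those compositions for line A rev 2 (stub A′ = the signed block average of `KMV2000.signedSecondGap`,
Literature `KMVSignedSecondGap`) and for its one-sided/band form (Literature `KMVSecondMomentBandSqueeze`,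
p533483): A′ ⇒ S2u (signature of `birth` rev 6 verbatim), A′ ⇒ K_B, band ⇒ K_B (rev-1 A ⇒ S2u is ls-Bfam-prover-1's
`upperSomewhere_X_sq_of_primeAveragedSecondDiagOnly`, p533786 — not repeated); rev 2: A″ (one-sided) ⇒ S2u; rev 3: A″ ⇒ K_B modulo
`kowalskiMichel2000_peterssonBound`. No Petersson
input anywhere. «The programme SEARCHES and TYPES; no claim about Landau–Siegel zeros, Theorems 1–2 of
arXiv:2211.02515 or a repaired Margin232 until a kernel theorem says so.»
-/

open Polynomial

namespace Summit.Parity.GeneralizedHardyLittlewood.Theorems.BeyondDiagonalBeatsQuarter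

open Literature.NumberTheory.LFunctions

/-- **A′ ⇒ K_B.** The signed prime-averaged display at `(X², 1)` on some `(1, b)` (stub
`stub_primeAveragedSignedSecondGapXSq` of line `prime-averaged-squeeze` rev 2) gives `BeyondDiagonalBeatsQuarter`:
Bettin (antecedent) + the landed `X²` main term ⇒ `T₁ = 0`; A′ + `MomentAsymptotics` ⇒ `T₂ = 0`; envelope `> ¼`. -/
theorem beyondDiagonalBeatsQuarter_of_signedGapAverageXSq
    (hA : ∃ b : ℝ, 1 < b ∧ ∀ Δ' : ℝ, 1 < Δ' → Δ' < b → ∀ ε : ℝ, 0 < ε → ∃ N₀ : ℕ, ∀ N : ℕ, N₀ ≤ N →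
      ‖∑ q ∈ KMV2000.goodPrimes Δ' N, KMV2000.signedSecondGap (X ^ 2) 1 Δ' q‖ ≤
        ε * ∑ q ∈ KMV2000.goodPrimes Δ' N, ‖KMV2000.mainScale q Δ'‖) :
    Summit.Parity.GeneralizedHardyLittlewood.Theses.PrimeLevelFamEdge.BeyondDiagonalBeatsQuarter := by
  obtain ⟨b, hb, hav⟩ := hA
  unfold Summit.Parity.GeneralizedHardyLittlewood.Theses.PrimeLevelFamEdge.BeyondDiagonalBeatsQuarter
  intro hF
  exact KMV2000.beatsQuarter_of_bettin_of_signedGap_average_X_sq hF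
    Summit.Parity.GeneralizedHardyLittlewood.Theses.PrimeLevelFamEdge.stub_mollifierMainTermXSq hb hav

/-- **A′ ⇒ S2u (the registered heart of line `birth`, signature verbatim).** The signed display pins
`T₂(Δ', X², 1) = 0` on `(1, min (min Δ 2) b)` (`KMV2000.T₂_eq_zero_of_signedGap_average`), and there
`second + 0 = 4 + 4/Δ' < 8 = 2·lin²`. A proof of A′ therefore lands as a proof of
`stub_secondCorrectionUpperSomewhere` by this composition. -/
theorem secondCorrectionUpperSomewhere_of_signedGapAverageXSq
    (hA : ∃ b : ℝ, 1 < b ∧ ∀ Δ' : ℝ, 1 < Δ' → Δ' < b → ∀ ε : ℝ, 0 < ε → ∃ N₀ : ℕ, ∀ N : ℕ, N₀ ≤ N →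
      ‖∑ q ∈ KMV2000.goodPrimes Δ' N, KMV2000.signedSecondGap (X ^ 2) 1 Δ' q‖ ≤
        ε * ∑ q ∈ KMV2000.goodPrimes Δ' N, ‖KMV2000.mainScale q Δ'‖) :
    ∀ Δ : ℝ, 1 < Δ → ∀ T₁ T₂ : ℝ → ℝ[X] → ℝ[X] → ℝ, KMV2000.MomentAsymptotics 1 Δ T₁ T₂ →
      ∃ a b : ℝ, 1 ≤ a ∧ a < b ∧ b ≤ min Δ 2 ∧ a < 3 / 2 ∧ ∀ Δ' : ℝ, a < Δ' → Δ' < b →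
        KMV2000.secondMomentForm Δ' (X ^ 2) 1 + T₂ Δ' (X ^ 2) 1 <
          2 * KMV2000.linForm Δ' (X ^ 2) 1 ^ 2 := by
  obtain ⟨b, hb, hav⟩ := hA
  intro Δ hΔ T₁ T₂ hMA
  refine ⟨1, min (min Δ 2) b, le_rfl, lt_min (lt_min hΔ (by norm_num)) hb, min_le_left _ _,
    by norm_num, fun Δ' h1 h2 ↦ ?_⟩
  have hΔ'Δ : Δ' ≤ Δ := h2.le.trans ((min_le_left _ _).trans (min_le_left _ _))
  have hΔ'2 : Δ' < 2 := lt_of_lt_of_le h2 ((min_le_left _ _).trans (min_le_right _ _))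
  have hΔ'b : Δ' < b := lt_of_lt_of_le h2 (min_le_right _ _)
  have e2 : T₂ Δ' (X ^ 2) 1 = 0 :=
    KMV2000.T₂_eq_zero_of_signedGap_average hMA KMV2000.admissible_X_sq KMV2000.isEvenOrOdd_one h1
      hΔ'Δ (by linarith) (KMV2000.goodPrimesUnbounded_of_lt_two (by linarith) hΔ'2) (hav Δ' h1 hΔ'b)
  rw [e2, add_zero, KMV2000.secondMomentForm_X_sq_one, KMV2000.linForm_X_sq_one]
  have hΔ'0 : 0 < Δ' := by linarith
  have : 4 / Δ' < 4 := by rw [div_lt_iff₀ hΔ'0]; linarith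
  linarith

/-- **Band along good primes ⇒ K_B** (the weakest, one-level-free form of the line; Literature
`KMVSecondMomentBandSqueeze`, p533483): if for every `Δ' ∈ (1, b)` the normalised second moment at `(X², 1)`
lies in a band `[δ, 2·lin² − δ]` at infinitely many good primes, then `BeyondDiagonalBeatsQuarter` — fact-free
(positivity from `Q^h(·,1) ≥ 0`), no Petersson. -/
theorem beyondDiagonalBeatsQuarter_of_bandAlongGoodPrimesXSq
    (hBand : ∃ b : ℝ, 1 < b ∧ ∀ Δ' : ℝ, 1 < Δ' → Δ' < b → ∃ δ : ℝ, 0 < δ ∧ ∀ q₀ : ℕ, ∃ q : ℕ,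
      ∃ _ : NeZero q, q₀ ≤ q ∧ q.Prime ∧ (∀ n : ℕ, (n : ℝ) ≠ KMV2000.qhat q ^ Δ') ∧
        δ * ‖KMV2000.mainScale q Δ'‖ ≤ ‖KMV2000.QhPQ q (X ^ 2) 1 (KMV2000.qhat q ^ Δ')‖ ∧
          ‖KMV2000.QhPQ q (X ^ 2) 1 (KMV2000.qhat q ^ Δ')‖ ≤
            (2 * KMV2000.linForm Δ' (X ^ 2) 1 ^ 2 - δ) * ‖KMV2000.mainScale q Δ'‖) :
    Summit.Parity.GeneralizedHardyLittlewood.Theses.PrimeLevelFamEdge.BeyondDiagonalBeatsQuarter := by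
  obtain ⟨b, hb, hband⟩ := hBand
  unfold Summit.Parity.GeneralizedHardyLittlewood.Theses.PrimeLevelFamEdge.BeyondDiagonalBeatsQuarter
  intro hF
  exact KMV2000.beatsQuarter_of_bettin_of_bandAlongGoodPrimes_X_sq hF
    Summit.Parity.GeneralizedHardyLittlewood.Theses.PrimeLevelFamEdge.stub_mollifierMainTermXSq hb hband

/-- **A″ ⇒ S2u (rev 2 of this file).** The ONE-SIDED signed display — «on signed average over the good
primes of dyadic blocks the mollified second moment at `(X², 1)` is NOT ABOVE its diagonal prediction»,
`re Σ_q signedSecondGap ≤ ε·Σ_q ‖mainScale‖` eventually, on some `(1, b)` (the referee's print-aligned A″) —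
gives `T₂(Δ', X², 1) ≤ 0` on `(1, min (min Δ 2) b)` (`KMV2000.T₂_nonpos_of_signedGap_re_average`, p536056)
and hence the registered heart S2u (ls-Bfam-prover-1's `upperSomewhere_X_sq_of_T₂_nonpos`, p533786:
`0 < 4(Δ'−1)/Δ'` for `Δ' > 1`). K_B itself then needs the positivity `0 < second + T₂`, which is line `birth`'s
floor (printed Petersson bound); the two-sided A′ route above is floor-free. -/
theorem secondCorrectionUpperSomewhere_of_signedGapReAverageXSq
    (hA : ∃ b : ℝ, 1 < b ∧ ∀ Δ' : ℝ, 1 < Δ' → Δ' < b → ∀ ε : ℝ, 0 < ε → ∃ N₀ : ℕ, ∀ N : ℕ, N₀ ≤ N →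
      (∑ q ∈ KMV2000.goodPrimes Δ' N, KMV2000.signedSecondGap (X ^ 2) 1 Δ' q).re ≤
        ε * ∑ q ∈ KMV2000.goodPrimes Δ' N, ‖KMV2000.mainScale q Δ'‖) :
    ∀ Δ : ℝ, 1 < Δ → ∀ T₁ T₂ : ℝ → ℝ[X] → ℝ[X] → ℝ, KMV2000.MomentAsymptotics 1 Δ T₁ T₂ →
      ∃ a b : ℝ, 1 ≤ a ∧ a < b ∧ b ≤ min Δ 2 ∧ a < 3 / 2 ∧ ∀ Δ' : ℝ, a < Δ' → Δ' < b →
        KMV2000.secondMomentForm Δ' (X ^ 2) 1 + T₂ Δ' (X ^ 2) 1 <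
          2 * KMV2000.linForm Δ' (X ^ 2) 1 ^ 2 := by
  obtain ⟨b, hb, hav⟩ := hA
  refine upperSomewhere_X_sq_of_T₂_nonpos fun Δ hΔ T₁ T₂ hMA ↦ ?_
  refine ⟨1, min (min Δ 2) b, le_rfl, lt_min (lt_min hΔ (by norm_num)) hb, min_le_left _ _,
    by norm_num, fun Δ' h1 h2 ↦ ?_⟩
  have hΔ'Δ : Δ' ≤ Δ := h2.le.trans ((min_le_left _ _).trans (min_le_left _ _))
  have hΔ'2 : Δ' < 2 := lt_of_lt_of_le h2 ((min_le_left _ _).trans (min_le_right _ _))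
  have hΔ'b : Δ' < b := lt_of_lt_of_le h2 (min_le_right _ _)
  exact KMV2000.T₂_nonpos_of_signedGap_re_average hMA KMV2000.admissible_X_sq KMV2000.isEvenOrOdd_one h1
    hΔ'Δ (by linarith) (KMV2000.goodPrimesUnbounded_of_lt_two (by linarith) hΔ'2) (hav Δ' h1 hΔ'b)

/-- **A″ ⇒ K_B modulo the route's printed Petersson bound (rev 3 of this file).** The one-sided signed
display gives S2u (`secondCorrectionUpperSomewhere_of_signedGapReAverageXSq`); the positivity
`0 < second + T₂` is the Cauchy–Schwarz floor `(lin + T₁)² ≤ second + T₂` from the harmonic masses at prime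
level (`KMV2000.sq_firstMainTerm_le_secondMainTerm_of_lt_two_of_masses`, fed by the in-range Petersson
bound at `(1,1)` and `(q,1)`: `CentralValueFamilyHalfEdge.abs_totalMass_sub_one_le_pb`,
`abs_two_mul_evenMass_sub_totalMass_le_pb`) with `T₁ = 0` (Bettin, the antecedent); then
`lin² ≤ D < 2·lin²` is `lin²/(2D) > ¼` — the argument of ls-Bfam-prover-1's
`beyondDiagonalBeatsQuarter_of_heart'` (HeartIsolationOffDiag), inlined here to keep this file's import
cone on Literature + the route file. CONDITIONAL on `kowalskiMichel2000_peterssonBound` (the route's support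
`PeterssonBoundPrinted`); the two-sided A′ route (`beyondDiagonalBeatsQuarter_of_signedGapAverageXSq`) needs
no Petersson input. -/
theorem beyondDiagonalBeatsQuarter_of_signedGapReAverageXSq_pb
    (hPet : KowalskiMichel2000.kowalskiMichel2000_peterssonBound)
    (hA : ∃ b : ℝ, 1 < b ∧ ∀ Δ' : ℝ, 1 < Δ' → Δ' < b → ∀ ε : ℝ, 0 < ε → ∃ N₀ : ℕ, ∀ N : ℕ, N₀ ≤ N →
      (∑ q ∈ KMV2000.goodPrimes Δ' N, KMV2000.signedSecondGap (X ^ 2) 1 Δ' q).re ≤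
        ε * ∑ q ∈ KMV2000.goodPrimes Δ' N, ‖KMV2000.mainScale q Δ'‖) :
    Summit.Parity.GeneralizedHardyLittlewood.Theses.PrimeLevelFamEdge.BeyondDiagonalBeatsQuarter := by
  unfold Summit.Parity.GeneralizedHardyLittlewood.Theses.PrimeLevelFamEdge.BeyondDiagonalBeatsQuarter
  intro hF Δ hΔ T₁ T₂ hMA
  obtain ⟨a, b, ha, hab, hb, ha32, hval⟩ :=
    secondCorrectionUpperSomewhere_of_signedGapReAverageXSq hA Δ hΔ T₁ T₂ hMA
  refine ⟨a, b, ha, hab, hb.trans (min_le_left _ _), ha32, X ^ 2, KMV2000.admissible_X_sq,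
    fun Δ' h1' h2' ↦ ?_⟩
  have h1 : 1 < Δ' := lt_of_le_of_lt ha h1'
  have hΔ'm : Δ' < min Δ 2 := lt_of_lt_of_le h2' hb
  have hΔ'Δ : Δ' ≤ Δ := (lt_of_lt_of_le hΔ'm (min_le_left _ _)).le
  have hΔ'2 : Δ' < 2 := lt_of_lt_of_le hΔ'm (min_le_right _ _)
  have hT₁ : T₁ Δ' (X ^ 2) 1 = 0 :=
    KMV2000.firstCorrectionVanishes_of_bettin hF
      Summit.Parity.GeneralizedHardyLittlewood.Theses.PrimeLevelFamEdge.stub_mollifierMainTermXSq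
      Δ hΔ T₁ T₂ hMA Δ' h1 hΔ'm
  obtain ⟨Ct, Ht⟩ := CentralValueFamilyHalfEdge.abs_totalMass_sub_one_le_pb hPet
  obtain ⟨Ce, He⟩ := CentralValueFamilyHalfEdge.abs_two_mul_evenMass_sub_totalMass_le_pb hPet
  have hfloor := KMV2000.sq_firstMainTerm_le_secondMainTerm_of_lt_two_of_masses
    ⟨Ct, 3 / 2, by norm_num, fun q _ hq ↦ Ht q hq⟩ ⟨Ce, 1 / 4, by norm_num, fun q _ hq ↦ He q hq⟩ hMA
    KMV2000.admissible_X_sq (by linarith) hΔ'2 h1 hΔ'Δ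
  have hv := hval Δ' h1' h2'
  rw [hT₁, add_zero] at hfloor ⊢
  rw [KMV2000.linForm_X_sq_one] at hfloor hv ⊢
  have hDpos : 0 < KMV2000.secondMomentForm Δ' (X ^ 2) 1 + T₂ Δ' (X ^ 2) 1 := by nlinarith
  rw [lt_div_iff₀ (by positivity)]
  linarith

end Summit.Parity.GeneralizedHardyLittlewood.Theorems.BeyondDiagonalBeatsQuarter
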